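import Mathlib

/-!
# `PolycrystalWulffBound`, line `PolyDensity`: real-arithmetic tail of the general single-axis rung
# (crux `stmt-Ventures-19482`)

Route `StickyWulffConstant` of the venture `Summits/Ventures/Crystal3D`, second prover lane (poly-p2,
gen 10).  The cube expansion and limit bookkeeping shared by the chimera rungs: from
`(x' + r c)³ ≤ V + r (F + ε/3)`, `V ≤ V' + r D K` (trimming loss), `x³ = V`, `x'³ = V'`, and the
smallness conditions on `r`, conclude `3 c x² ≤ F + σ + ε`.
WHAT THIS IS NOT: anything geometric; the crux is not claimed.
-/

namespace Summit.Ventures.Crystal3D.Cruxes.PolycrystalWulffBound.PolyDensity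

/-- Real-arithmetic tail of the rung: cube expansion and the limit bookkeeping. -/
theorem cube_tail_bound {V V' r c D K F σ ε x x' : ℝ} (hr : 0 < r) (hc : 0 < c) (hx : 0 < x)
    (hx'0 : 0 ≤ x') (hx3 : x ^ 3 = V) (hx'3 : x' ^ 3 = V') (hV'V : V' ≤ V)
    (hVV' : V ≤ V' + r * D * K) (hcube : (x' + r * c) ^ 3 ≤ V + r * (F + ε / 3))
    (hrε : 6 * c * (r * D * K) / x ≤ ε / 3) (hDK : D * K ≤ σ + ε / 3) :
    3 * c * x ^ 2 ≤ F + σ + ε := by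
  -- `V' + 3 r c x'² ≤ (x' + r c)³ ≤ V + r(F + ε/3) ≤ V' + r D K + r (F + ε/3)`
  have hexp3 : x' ^ 3 + 3 * x' ^ 2 * (r * c) ≤ (x' + r * c) ^ 3 := by
    have e : (x' + r * c) ^ 3 = x' ^ 3 + 3 * x' ^ 2 * (r * c) + (3 * x' * (r * c) ^ 2 + (r * c) ^ 3) := by
      ring
    have hpos : 0 ≤ 3 * x' * (r * c) ^ 2 + (r * c) ^ 3 := by positivity
    rw [e]; linarith only [hpos]
  have h3 : r * (3 * c * x' ^ 2) ≤ r * (D * K + F + ε / 3) := by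
    have e1 : r * (3 * c * x' ^ 2) = 3 * x' ^ 2 * (r * c) := by ring
    have e2 : r * (D * K + F + ε / 3) = r * D * K + r * (F + ε / 3) := by ring
    rw [e1, e2]
    linarith only [hexp3, hcube, hVV', hx'3]
  have h4 : 3 * c * x' ^ 2 ≤ D * K + F + ε / 3 := le_of_mul_le_mul_left h3 hr
  -- `x² ≤ x'² + 2 r D K / x`
  have hx'x : x' ≤ x := by
    by_contra h
    push Not at h
    have : x ^ 3 < x' ^ 3 := by gcongr
    linarith only [this, hx3, hx'3, hV'V]
  have hdiff : (x - x') * x ^ 2 ≤ x ^ 3 - x' ^ 3 := by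
    have e : x ^ 3 - x' ^ 3 - (x - x') * x ^ 2 = x' * (x - x') * (x + x') := by ring
    have hp : 0 ≤ x' * (x - x') * (x + x') :=
      mul_nonneg (mul_nonneg hx'0 (sub_nonneg.2 hx'x)) (by positivity)
    linarith only [e, hp]
  have hVV'' : x ^ 3 - x' ^ 3 ≤ r * D * K := by rw [hx3, hx'3]; linarith only [hVV']
  have h5 : (x ^ 2 - x' ^ 2) * x ≤ 2 * (r * D * K) := by
    have e1 : (x ^ 2 - x' ^ 2) * x = (x - x') * x ^ 2 + (x - x') * (x' * x) := by ring
    have e2 : (x - x') * (x * x) - (x - x') * (x' * x) = (x - x') ^ 2 * x := by ring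
    have hsq : 0 ≤ (x - x') ^ 2 * x := by positivity
    have e3 : (x - x') * (x * x) = (x - x') * x ^ 2 := by ring
    rw [e1]
    linarith only [hdiff, hVV'', e2, e3, hsq]
  have h5' : x ^ 2 - x' ^ 2 ≤ 2 * (r * D * K) / x := by
    rw [le_div_iff₀ hx]; exact h5
  have h6c : 3 * c * x ^ 2 ≤ 3 * c * x' ^ 2 + 6 * c * (r * D * K) / x := by
    have := mul_le_mul_of_nonneg_left h5' (show 0 ≤ 3 * c by positivity)
    have e : 3 * c * (2 * (r * D * K) / x) = 6 * c * (r * D * K) / x := by ring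
    linarith only [this, e]
  linarith only [h4, h6c, hDK, hrε]

end Summit.Ventures.Crystal3D.Cruxes.PolycrystalWulffBound.PolyDensity
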